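import Summits.PneNP.PneNP.Theorems.NegLimitedHalfWindowSlicesVerifier
import Summits.PneNP.PneNP.Theorems.NegLimitedHalfWindowDoorAssembly
import Summits.PneNP.PneNP.Theorems.NegLimitedAmplifiedWindowSlicesEval
import Literature.NumberTheory.Automorphic.ShimuraCurveRibetTakahashiPeterssonTwoPowerLevelProofs
import Mathlib
import HarnessLib

/-!
# Half window — stub S′, part 3: decoding the length; the slice in closed form; block cliques
(cell pnp-ideate, rung F-N1/p3, ROUND-13; line `half-window` on item stmt-PneNP-19888, stub S′
`HalfSlicesNP`; card HOME/pnp-ideate-p3/r13/half-window.md)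

Between the verifier (`NegLimitedHalfWindowSlicesVerifier.lean`, `…SlicesLang.lean`) and the slice theorem
(`NegLimitedHalfWindowSlicesNP.lean`):
* `mCal_mono`, `hP_mono`, `halfLen_inj` (with the tree's `two_pow_mul_odd_inj`): the length
  `halfLen n kc r = 2^{pair r kc}·(2·hP·n² + 1)` (`3 ≤ kc < n`, `1 ≤ r`) determines `(n, kc, r)` (2-adic
  valuation + strict monotonicity of `n ↦ hP(n,r)·n²`), and `params_of_checks`: the verifier's checks pin the
  certificate's parameters to the true ones (`m = mCal w` by the exact floor test `eq_mCal_of_bounds`);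
* the block numbering `hIdx : HBlk n r ≃ Fin (hP n r)` (`((j,i),u) ↦ ffe u + 3^d·(i + w·j)`), `blockVec`,
  `halfSlice n kc r x = TRIBES_{w,m}(RM3_d(CLIQUE(n,kc)(block)))`, its monotonicity and values at the constant
  inputs, and `clique_of_blockBit'` (an accepted block has a `kc`-clique; the door's `SlicesNP.blockBit`).

HONEST FRAMING: slice plumbing for stub S′ of an OPEN line; FRONTIER rung F-N1 — nothing here bears on P vs NP.
-/

set_option linter.dupNamespace false -- `Summit.PneNP.PneNP.…`: summit = sub-problem name (D-0017 single-conjunct layout)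

namespace Summit.PneNP.PneNP.Theorems.NegLimitedHalfWindow

open Finset
open Literature.Computability.Complexity Literature.Barriers.PneNP
open Summit.PneNP.PneNP.Theorems.NegLimSlices
open Summit.PneNP.PneNP.Theorems.NegLimitedAmplifiedWindow (Edge recMaj3 recMaj3_monotone recMaj3_const)
open Summit.PneNP.PneNP.Theorems.NegLimitedAmplifiedWindow.SlicesNP (blockBit blockBit_eq_true_iff markCount_eq_card)
open HalfSlices

/-! ### The length code is injective -/

/-- The calibration is monotone in the width. -/
theorem mCal_mono {w w' : ℕ} (h : w ≤ w') : mCal w ≤ mCal w' := by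
  unfold mCal
  refine Nat.floor_le_floor ?_
  calc ∑ j ∈ Finset.Icc 1 w, (2 : ℚ) ^ (w - j) / (j : ℚ)
      ≤ ∑ j ∈ Finset.Icc 1 w, (2 : ℚ) ^ (w' - j) / (j : ℚ) := by
        refine Finset.sum_le_sum fun j hj => ?_
        have hj : (0 : ℚ) ≤ (j : ℚ) := by positivity
        exact div_le_div_of_nonneg_right (pow_le_pow_right₀ (by norm_num) (by omega)) hj
    _ ≤ ∑ j ∈ Finset.Icc 1 w', (2 : ℚ) ^ (w' - j) / (j : ℚ) :=
        Finset.sum_le_sum_of_subset_of_nonneg (Finset.Icc_subset_Icc le_rfl h) fun j _ _ => by positivity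

/-- `hP` is monotone in `n`. -/
theorem hP_mono {n n' : ℕ} (r : ℕ) (h : n ≤ n') : hP n r ≤ hP n' r := by
  have hw : wOf n r ≤ wOf n' r := by
    unfold wOf; exact Nat.mul_le_mul_left _ (Nat.log_mono_right h)
  unfold hP
  exact Nat.mul_le_mul (Nat.mul_le_mul (mCal_mono hw) hw)
    (Nat.pow_le_pow_right (by norm_num) (by unfold dCal; have := Nat.log_mono_right (b := 2) hw; omega))

/-- `n ↦ hP(n,r)·n²` is strictly increasing on `n ≥ 2` (`r ≥ 1`). -/
theorem hPsq_lt {n n' r : ℕ} (hn : 2 ≤ n) (hnn : n < n') (hr : 1 ≤ r) :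
    hP n r * n ^ 2 < hP n' r * n' ^ 2 := by
  have h1 : hP n r ≤ hP n' r := hP_mono r hnn.le
  have h2 : 1 ≤ hP n' r := one_le_hP hr (by omega)
  have h3 : n ^ 2 < n' ^ 2 := Nat.pow_lt_pow_left hnn (by norm_num)
  calc hP n r * n ^ 2 ≤ hP n' r * n ^ 2 := Nat.mul_le_mul_right _ h1
    _ < hP n' r * n' ^ 2 := Nat.mul_lt_mul_of_pos_left h3 (by omega)

/-- **The length determines the parameters**: `halfLen` is injective on `n ≥ 2`, `r ≥ 1`. -/
theorem halfLen_inj {n kc r n' kc' r' : ℕ} (hn : 2 ≤ n) (hn' : 2 ≤ n') (hr : 1 ≤ r) (hr' : 1 ≤ r')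
    (h : halfLen n kc r = halfLen n' kc' r') : n = n' ∧ kc = kc' ∧ r = r' := by
  unfold halfLen at h
  obtain ⟨h1, h2⟩ := Literature.NumberTheory.Automorphic.two_pow_mul_odd_inj (odd_two_mul_add_one _)
    (odd_two_mul_add_one _) h
  obtain ⟨hrr, hkk⟩ := Nat.pair_eq_pair.1 h1
  subst hrr hkk
  have h3 : hP n r * n ^ 2 = hP n' r * n' ^ 2 := by omega
  rcases lt_trichotomy n n' with hlt | rfl | hlt
  · exact absurd h3 (ne_of_lt (hPsq_lt hn hlt hr))
  · exact ⟨rfl, rfl, rfl⟩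
  · exact absurd h3.symm (ne_of_lt (hPsq_lt hn' hlt hr))

/-- **The checks pin the parameters**: under `checks`, the certificate's fields are the true `n, kc, r`,
`w = wOf n r`, `m = mCal w`, `d = dCal w`. -/
theorem params_of_checks {n kc r : ℕ} (hk : 3 ≤ kc) (hkn : kc < n) (hr : 1 ≤ r) {u y : List Bool}
    (hu : u.length = halfLen n kc r) (hc : checks u y = true) :
    pN y = n ∧ pK y = kc ∧ pR y = r ∧ pW y = wOf n r ∧ pM y = mCal (wOf n r) ∧ pD y = dCal (wOf n r) := by
  obtain ⟨hk', hkn', hr', hL1, hL2, hw, hLw1, hLw2, hP', hm1, hm2, hd, hlen⟩ := checks_eq_true_iff.1 hc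
  have hL : pL y = Nat.log 2 (pN y) := (Nat.log_eq_of_pow_le_of_lt_pow hL1 hL2).symm
  have hwOf : pW y = wOf (pN y) (pR y) := by rw [hw, wOf, hL]
  have hLw : pLw y = Nat.log 2 (pW y) := (Nat.log_eq_of_pow_le_of_lt_pow hLw1 hLw2).symm
  have hdCal : pD y = dCal (pW y) := by rw [hd, dCal, hLw]
  have hmCal : pM y = mCal (pW y) := eq_mCal_of_bounds hm1 hm2
  have hlen' : halfLen n kc r = halfLen (pN y) (pK y) (pR y) := by
    rw [← hu, hlen]
    unfold halfLen hP
    rw [← hwOf, ← hmCal, ← hdCal, ← hP', pow_two]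
  obtain ⟨h1, h2, h3⟩ := halfLen_inj (by omega) (by omega) hr hr' hlen'
  refine ⟨h1.symm, h2.symm, h3.symm, ?_, ?_, ?_⟩
  · rw [hwOf, h1, h3]
  · rw [hmCal, hwOf, h1, h3]
  · rw [hdCal, hwOf, h1, h3]

/-! ### Blocks and the slice in closed form -/

variable {n kc r : ℕ}

/-- The block numbering `((j,i),u) ↦ ffe u + 3^d·(i + w·j)` of `HBlk n r` by `Fin (hP n r)`. -/
def hIdx (n r : ℕ) : HBlk n r ≃ Fin (hP n r) :=
  ((Equiv.prodCongr finProdFinEquiv finFunctionFinEquiv).trans finProdFinEquiv :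
    HBlk n r ≃ Fin (mCal (wOf n r) * wOf n r * 3 ^ dCal (wOf n r)))

/-- Its value. -/
theorem hIdx_val (n r : ℕ) (b : HBlk n r) :
    ((hIdx n r b : Fin (hP n r)) : ℕ) =
      (finFunctionFinEquiv b.2 : ℕ) + 3 ^ dCal (wOf n r) * ((b.1.2 : ℕ) + wOf n r * (b.1.1 : ℕ)) := by
  show ((finProdFinEquiv ((finProdFinEquiv b.1 : Fin (mCal (wOf n r) * wOf n r)), finFunctionFinEquiv b.2) :
      Fin (mCal (wOf n r) * wOf n r * 3 ^ dCal (wOf n r))) : ℕ) = _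
  simp only [finProdFinEquiv_apply_val]

/-- A block's `n × n` bit matrix lies inside the input. -/
theorem blockPos_lt (β : Fin (hP n r)) (t : Fin (n * n)) : (β : ℕ) * (n * n) + t < halfLen n kc r := by
  have hβ := β.2
  have ht := t.2
  unfold halfLen
  have h1 : ((β : ℕ) + 1) * (n * n) ≤ hP n r * (n * n) := Nat.mul_le_mul_right _ hβ
  calc (β : ℕ) * (n * n) + t < (β : ℕ) * (n * n) + n * n := by omega
    _ = ((β : ℕ) + 1) * (n * n) := by ring
    _ ≤ hP n r * (n * n) := h1
    _ ≤ 2 * (hP n r * n ^ 2) + 1 := by rw [pow_two]; omega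
    _ ≤ 2 ^ Nat.pair r kc * (2 * (hP n r * n ^ 2) + 1) := Nat.le_mul_of_pos_left _ (Nat.two_pow_pos _)

/-- The `β`-th block of `x` as an `n × n` bit matrix. -/
def blockVec (x : Fin (halfLen n kc r) → Bool) (β : Fin (hP n r)) : Fin (n * n) → Bool :=
  fun t => x ⟨(β : ℕ) * (n * n) + t, blockPos_lt β t⟩

/-- The slice function in closed form: `TRIBES_{w,m}` of `RM3_d` of the block clique indicators. -/
noncomputable def halfSlice (n kc r : ℕ) (x : Fin (halfLen n kc r) → Bool) : Bool :=
  tribes (wOf n r) (mCal (wOf n r)) fun ji =>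
    recMaj3 (dCal (wOf n r)) fun u => cliqueFn n kc (edgeVec (blockVec x (hIdx n r (ji, u))))

/-- `halfSlice` is monotone. -/
theorem halfSlice_monotone (n kc r : ℕ) : Monotone (halfSlice n kc r) := by
  intro x x' hxx'
  refine tribes_monotone _ _ fun ji => recMaj3_monotone _ fun u => cliqueFn_monotone_holds n kc fun e => ?_
  exact hxx' _

/-- Reading position `β n² + t` of `ofFn x` reads the block matrix. -/
theorem getD_ofFn_block' (x : Fin (halfLen n kc r) → Bool) (β : Fin (hP n r)) {t : ℕ} (ht : t < n * n) :
    (List.ofFn x).getD ((β : ℕ) * (n * n) + t) false = blockVec x β ⟨t, ht⟩ := by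
  rw [Kannan.getD_ofFn x (blockPos_lt β ⟨t, ht⟩)]
  rfl

/-- Soundness of a block bit: an accepted block has a `kc`-clique. -/
theorem clique_of_blockBit' (x : Fin (halfLen n kc r) → Bool) (T : List Bool) (β : Fin (hP n r))
    (h : blockBit (List.ofFn x) T n kc β = true) : cliqueFn n kc (edgeVec (blockVec x β)) = true := by
  classical
  obtain ⟨hcnt, hpairs⟩ := blockBit_eq_true_iff.1 h
  rw [cliqueFn_edgeVec_iff]
  refine ⟨univ.filter fun v : Fin n => T.getD ((β : ℕ) * n + v) false = true, ?_, ?_⟩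
  · rw [card_filter_univ_fin n fun v => T.getD ((β : ℕ) * n + v) false = true, ← markCount_eq_card, hcnt]
  · intro a ha b hb hab hlt
    simp only [mem_filter, mem_univ, true_and] at ha hb
    have h1 := hpairs a b a.2 b.2 hab ha hb
    rwa [getD_ofFn_block' x β hlt] at h1

/-- All clique indicators of the all-`b` input are `b` (`3 ≤ kc ≤ n`). -/
theorem clique_blockVec_const (hk : 3 ≤ kc) (hkn : kc ≤ n) (b : Bool) (β : Fin (hP n r)) :
    cliqueFn n kc (edgeVec (blockVec (kc := kc) (fun _ => b) β)) = b := by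
  classical
  cases b
  · rw [Bool.eq_false_iff, Ne, cliqueFn_edgeVec_iff]
    rintro ⟨S, hcard, hS⟩
    have h2 : 1 < S.card := by omega
    obtain ⟨a, ha, c, hc, hac⟩ := Finset.one_lt_card.1 h2
    rcases lt_or_gt_of_ne hac with hlt | hlt
    · have := hS a ha c hc hlt (by have := a.2; have := c.2; nlinarith)
      simp [blockVec] at this
    · have := hS c hc a ha hlt (by have := a.2; have := c.2; nlinarith)
      simp [blockVec] at this
  · rw [cliqueFn_edgeVec_iff]
    obtain ⟨S, hS⟩ := (Finset.powersetCard_nonempty (s := (univ : Finset (Fin n))) (n := kc)).2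
      (by rw [card_univ, Fintype.card_fin]; exact hkn)
    exact ⟨S, (mem_powersetCard.1 hS).2, fun a _ c _ _ _ => rfl⟩

/-- The slice is non-constant: all-zero input (`w ≥ 1`). -/
theorem halfSlice_false (hk : 3 ≤ kc) (hkn : kc ≤ n) (hw : 1 ≤ wOf n r) :
    halfSlice n kc r (fun _ => false) = false := by
  unfold halfSlice
  simp only [clique_blockVec_const hk hkn false, recMaj3_const]
  simp only [tribes, decide_eq_false_iff_not, not_exists, not_forall]
  exact fun _ => ⟨⟨0, hw⟩, by simp⟩

/-- The slice is non-constant: all-one input (`m ≥ 1`). -/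
theorem halfSlice_true (hk : 3 ≤ kc) (hkn : kc ≤ n) (hm : 1 ≤ mCal (wOf n r)) :
    halfSlice n kc r (fun _ => true) = true := by
  unfold halfSlice
  simp only [clique_blockVec_const hk hkn true, recMaj3_const]
  simp only [tribes, decide_eq_true_iff]
  exact ⟨⟨0, hm⟩, fun _ => trivial⟩

end Summit.PneNP.PneNP.Theorems.NegLimitedHalfWindow
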